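import Summits.QuantumFields.BalabanUV.T4Continuum.Support.NE7HapeOfLocalChartAllN
import Summits.QuantumFields.BalabanUV.T4Continuum.Support.NE7OneStepOfRoutePi
import HarnessLib

/-!
# NE7 — ONE-STEP ⇐ the local chart (N1)-weak ∧ the budget ∧ row NE3's leaves (F283)

[Balaban1985Variational] Prop 8 ∘ [Balaban1983Laplace] Thm 2 — the composition of the two ends of
record of row NE7:

* F31 `NE7OneStepOfRoutePi.oneStep_of_dataClass_ape_routePi`: the SMALL-FIELD ONE-STEP (existence of a
  minimiser of the block-averaged action in the small field `δ/M²` at every level, `M = L^(k+1)`) on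
  the data class, from (APE) on the data class (`hape`), row NE3's per-pair binder (`hleaves`), the
  slice Poincaré inequality and route Π's two `k`-free numeric lines;
* F282 `NE7HapeOfLocalChartAllN.hape_of_localChart_budget_allN`: (APE) on the data class (every period
  `N ≥ 1`) from THE LOCAL CHART (N1)-weak — [B8] Thm 2 at `U₀ = 1` on the nested cubes of radius
  `(nbRad + 2ℓ + 10)·M`, stated on the `(4ℓ + 12)`-fold cover — the multi-level class smallness, F51's
  three bounds and the two closed-form budget inequalities of F280 (the torus road v4, F263, with the
  (N2) defect repaired at the Hessian level, F273–F281).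

Here `hape` is discharged by F282, in dimension `d + 1` and in the regime `δ₁ < δ < ε`,
`c₀ + θδ ≤ δ`, `c₀/(1 − θ) < δ₁` (e.g. `δ = ε/2`, `δ₁ = ε/4`, `θ = 1/4`, `c₀ = ε/8`).  What remains
asserted-for-nothing in the bill: THE CHART (the `hchart` binder, [B8] Thm 2 TYPE on cubes) and row
NE3's `hleaves` ([B11] Prop 2 TYPE); everything else is class smallness and closed-form numeric lines in
the letters `(K, c)` of F263's slice Green's function and the chart constants `(C₀, C₁)`.
-/

open scoped BigOperators Matrix Matrix.Norms.L2Operator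
open NormedSpace Finset Set

namespace Summit.QuantumFields.BalabanUV.T4Continuum.NE7OneStepOfLocalChart

open Literature.MathematicalPhysics.QuantumFieldTheory.Balaban1983to89
open B7Prop1Explicit B7Prop2Explicit MatrixLog UnitaryModel
open B4TorusKernel.MultiPeriod (torusSupNorm)
open T4AveragingDeficitWall (IsUnitaryCfg IsSkewDir SmallField vary curl curlSq dirSq dirL1)
open T4AveragingDeficitWallBoundary (IsPeriodicCfg periodBox)
open AveragingDeficitPeriodicCounting (IsPeriodicDir)
open AveragingDeficitMultiLevelPrep (LevelSmall tower TangentIter)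
open BlockAverageVaryHolo (nbRad)
open BlockAverageVaryDisc (rho0)
open MinimalActionLevels (perWin)
open MinimalActionSandwich (IsMinimiser admissible)
open MinimalActionRate (sfClass)
open NE3HessForm (dAction)
open NE3SlicePoincareShape (SlicePoincare)
open NE3FrameFreeSliceW (frameFreeBlockLandauW)
open NE3TangentCovariantTower (dirIter)
open NE3DecomposedRepOfLinearNormalPart (ResidualSliceRepT)
open NE3QbarIterCovLiftPrep (cruxC)
open NE3SmoothRightInverseW (rightInvW)
open NE3RightInverseSolveLetters (thetaLoc)
open NE3RightInverseL2Letter (l2C)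
open NE3HatInvCurlLetters (curl2C curl1C)
open B4Sect5Proof (latticeConst)
open B5Hk163Strip (kappa163)
open B5Hk163TorusHolderDecay (CdecD)
open NE3EnergyShapes (IsUnitarySite)
open BlockAveragePushDirSplit (flat)
open NE7HapeOfLocalChartAllN (hape_of_localChart_budget_allN)
open NE7OneStepOfRoutePi (oneStep_of_dataClass_ape_routePi)

variable {d : ℕ} {n : Type*} [Fintype n] [DecidableEq n]

set_option maxHeartbeats 400000 in
/-- **F283 — the small-field ONE-STEP from the local chart.**  [Balaban1985Variational] Prop 8 ∘
[Balaban1983Laplace] Thm 2, rows NE7 ∘ NE3: there are constants `K ≥ 0`, `c > 0` (F263's slice Green's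
function letters) such that, for every period `N ≥ 1`, every `ℓ ≥ 1` and all data
`(ε, δ, δ₁, CP, β, c₀, θ, C₀, C₁, C₂, αh, Ch, νh, κh)` satisfying F31's hypotheses (class smallness,
`δ₁ < δ < ε`, slice Poincaré with constant `CP`, route Π's two `k`-free lines), F282's hypotheses (the
regime of `(c₀, θ)`, F51's three bounds, `C₀T ≤ 1` and the two closed-form budget inequalities,
`T = δ + 4(e^β − 1) + ε`), THE LOCAL CHART (N1)-weak on the `(4ℓ + 12)`-fold cover and row NE3's
per-pair binder `hleaves`, the ONE-STEP holds: some `γ > 0` such that below every `N`-periodic unitary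
`V` in the small field `γ`, at every level `k + 1`, an admissible `U₀` in the small field `δ/(L^k)²`
yields a minimiser in the small field `δ/(L^(k+1))²`. -/
theorem oneStep_of_dataClass_chart_routePi [Nonempty n] {L : ℕ} [NeZero L] (hL : 2 ≤ L) :
    ∃ K c : ℝ, 0 ≤ K ∧ 0 < c ∧ ∀ (N ℓ : ℕ) [NeZero N] (ε δ δ₁ CP β c₀ θ C₀ C₁ C₂ αh Ch νh κh : ℝ), 1 ≤ N →
    -- F31's hypotheses (route Π, dimension `d + 1`): class smallness, the regime `δ₁ < δ < ε`, slice Poincaré, the two k-free lines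
    0 < ε →
    16 * C0 (d + 1) * ε ≤ 3 →
    1024 * (((d + 1 : ℕ) : ℝ) + 1) * (((d + 1 : ℕ) : ℝ) + 4) * (L : ℝ) ^ 2 * ε ≤ 1 →
    0 ≤ δ₁ →
    δ₁ < δ →
    δ < ε →
    0 < CP →
    0 < β →
    (∀ k : ℕ, LevelSmall (d + 1) L k (ε / ((L : ℝ) ^ (k + 1)) ^ 2)) →
    (∀ (j : ℕ) (W' : Site (d + 1) → Fin (d + 1) → (Matrix n n ℂ)ˣ), W' ∈ sfClass (d + 1) L N ε (j + 1) → SlicePoincare L (j + 1) W' (frameFreeBlockLandauW L N (j + 1) W') CP (periodBox (d := d + 1) (N * L ^ (j + 1)))) →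
    thetaLoc (d + 1) L * ε < 1 →
    ε ≤ 1 →
    0 ≤ C₂ →
    0 ≤ αh →
    αh ≤ 1 →
    0 ≤ Ch →
    νh = 2 * Real.sqrt (l2C (d + 1) L / (1 - thetaLoc (d + 1) L * ε) ^ 2 + curl2C (d + 1) L / (1 - thetaLoc (d + 1) L * ε) ^ 2) * C₂ * Ch * αh →
    κh = 4 * (curl1C (d + 1) L / (1 - thetaLoc (d + 1) L * ε)) * C₂ * Ch ^ 2 * ε →
    νh < 1 →
    2 * (κh / (1 - νh) ^ 2) < ((((1 / 2 - (νh / (1 - νh)) ^ 2) / (2 * (1 + CP)) - (νh / (1 - νh)) ^ 2) / 2 - 576 * ((d + 1 : ℕ) : ℝ) * (αh ^ 2 * Real.exp (2 * αh))) / (Fintype.card n : ℝ) - 28 * ((d + 1 : ℕ) : ℝ) * (ε + 7 * αh ^ 2)) →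
    -- F282's hypotheses: the regime of `(c₀, θ)`, `cruxC`, the chart constants, F51's bounds, the budget, THE CHART on the cover
    1 ≤ ℓ →
    0 ≤ c₀ → 0 ≤ θ → θ < 1 → c₀ + θ * δ ≤ δ → c₀ / (1 - θ) < δ₁ →
    cruxC (d + 1) L * ε < 1 →
    -- the chart constants and F51's smallness of `C₀·(δ + 4(e^β − 1) + ε)`
    0 ≤ C₀ → 0 ≤ C₁ →
    4 * (3 + 12 * ((d + 1 : ℕ) : ℝ)) ^ 2 * (C₀ * (δ + 4 * (Real.exp β - 1) + ε)) ≤ rho0 (d + 1) L ^ 2 →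
    (8 * (3 + 12 * ((d + 1 : ℕ) : ℝ)) * (2 + 2 * ((((d + 1 : ℕ) : ℝ) + 1) * L)
        * (1 + ((1250 * ((nbRad (d + 1) L : ℝ) + L) + 8 * (((d + 1 : ℕ) : ℝ) * L) + 2 * L) * (((d + 1 : ℕ) : ℝ) * (2 * nbRad (d + 1) L + 1) ^ (d + 1)))
          / ((L : ℝ) / (L : ℝ) ^ (d + 1))))) * (C₀ * (δ + 4 * (Real.exp β - 1) + ε)) ≤ 1 →
    256 * (((d + 1 : ℕ) : ℝ) + 1) * L * (3 + 12 * ((d + 1 : ℕ) : ℝ)) * (C₀ * (δ + 4 * (Real.exp β - 1) + ε)) ≤ 1 →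
    -- THE BUDGET (F280): `C₀T ≤ 1` and the two closed-form inequalities
    C₀ * (δ + 4 * (Real.exp β - 1) + ε) ≤ 1 →
    ((K * (2 * (curl1C (d + 1) L / (1 - thetaLoc (d + 1) L * ε)) * (8 * (3 + 12 * ((d + 1 : ℕ) : ℝ)) * (2 + 2 * ((((d + 1 : ℕ) : ℝ) + 1) * L)
        * (1 + ((1250 * ((nbRad (d + 1) L : ℝ) + L) + 8 * (((d + 1 : ℕ) : ℝ) * L) + 2 * L) * (((d + 1 : ℕ) : ℝ) * (2 * nbRad (d + 1) L + 1) ^ (d + 1)))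
          / ((L : ℝ) / (L : ℝ) ^ (d + 1))))) * (C₀ * (δ + 4 * (Real.exp β - 1) + ε))) + K * Real.exp (-(c * ℓ)) * (2 * (curl1C (d + 1) L / (1 - thetaLoc (d + 1) L * ε)) * (8 * (3 + 12 * ((d + 1 : ℕ) : ℝ)) * (2 + 2 * ((((d + 1 : ℕ) : ℝ) + 1) * L)
        * (1 + ((1250 * ((nbRad (d + 1) L : ℝ) + L) + 8 * (((d + 1 : ℕ) : ℝ) * L) + 2 * L) * (((d + 1 : ℕ) : ℝ) * (2 * nbRad (d + 1) L + 1) ^ (d + 1)))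
          / ((L : ℝ) / (L : ℝ) ^ (d + 1))))) * (C₀ * (δ + 4 * (Real.exp β - 1) + ε)) + (curl1C (d + 1) L / (1 - thetaLoc (d + 1) L * ε))))
      + (K * ((Fintype.card (T4AveragingDeficitWall.Plane (d + 1)) : ℝ) * (((δ + 4 * (Real.exp β - 1) + ε) * (144 * C₀ * C₁ + 8 * C₁ ^ 2) + (δ + 4 * (Real.exp β - 1) + ε) ^ 2 * (5440 * C₀ ^ 3 + 304 * C₁ * C₀ ^ 2) + (δ + 4 * (Real.exp β - 1) + ε) ^ 3 * (2688 * C₀ ^ 4)) + 2 * ((δ + 4 * (Real.exp β - 1) + ε) * (144 * C₀ * (C₀ + C₁) + 8 * (C₀ + C₁) ^ 2) + (δ + 4 * (Real.exp β - 1) + ε) ^ 2 * (5440 * C₀ ^ 3 + 304 * (C₀ + C₁) * C₀ ^ 2) + (δ + 4 * (Real.exp β - 1) + ε) ^ 3 * (2688 * C₀ ^ 4))))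
      + K * Real.exp (-(c * ℓ)) * ((Fintype.card (T4AveragingDeficitWall.Plane (d + 1)) : ℝ) * (((δ + 4 * (Real.exp β - 1) + ε) * (144 * C₀ * C₁ + 8 * C₁ ^ 2) + (δ + 4 * (Real.exp β - 1) + ε) ^ 2 * (5440 * C₀ ^ 3 + 304 * C₁ * C₀ ^ 2) + (δ + 4 * (Real.exp β - 1) + ε) ^ 3 * (2688 * C₀ ^ 4)) + 2 * ((δ + 4 * (Real.exp β - 1) + ε) * (144 * C₀ * (C₀ + C₁) + 8 * (C₀ + C₁) ^ 2) + (δ + 4 * (Real.exp β - 1) + ε) ^ 2 * (5440 * C₀ ^ 3 + 304 * (C₀ + C₁) * C₀ ^ 2) + (δ + 4 * (Real.exp β - 1) + ε) ^ 3 * (2688 * C₀ ^ 4))) + 4 * (Fintype.card (T4AveragingDeficitWall.Plane (d + 1)) : ℝ) * (C₀ + C₁))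
      + (Fintype.card n : ℝ) * (2 * (CdecD d * (((d : ℝ) + 1) * (2 * ((d : ℝ) + 1))
              * ((2 + 32 / (kappa163 (d + 1) / (d + 1)) ^ 2) * latticeConst (d + 1) (kappa163 (d + 1) / (d + 1) / 2))))) * (1 + 12 * ((d : ℝ) + 1)) * ((28 * ((3 + 12 * ((d + 1 : ℕ) : ℝ)) + (4 * (3 + 12 * ((d + 1 : ℕ) : ℝ)) ^ 3 / rho0 (d + 1) L ^ 2) * (C₀ * (δ + 4 * (Real.exp β - 1) + ε))) ^ 2 + 4 * (4 * (3 + 12 * ((d + 1 : ℕ) : ℝ)) ^ 3 / rho0 (d + 1) L ^ 2)) * (C₀ ^ 2 * (δ + 4 * (Real.exp β - 1) + ε)))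
      + ((Fintype.card n : ℝ) * (2 * (CdecD d * (((d : ℝ) + 1) * (latticeConst (d + 1) (kappa163 (d + 1) / (d + 1) / 2) * Real.exp (-(kappa163 (d + 1) / (d + 1) / 2 * ℓ))))))) * ((3 + 12 * ((d + 1 : ℕ) : ℝ)) * C₀ + ((d : ℝ) + 1) * (4 * ((ℓ + 1 : ℕ) : ℝ) + 2) * (2 * (3 + 12 * ((d + 1 : ℕ) : ℝ)) * C₀ + ((28 * ((3 + 12 * ((d + 1 : ℕ) : ℝ)) + (4 * (3 + 12 * ((d + 1 : ℕ) : ℝ)) ^ 3 / rho0 (d + 1) L ^ 2) * (C₀ * (δ + 4 * (Real.exp β - 1) + ε))) ^ 2 + 4 * (4 * (3 + 12 * ((d + 1 : ℕ) : ℝ)) ^ 3 / rho0 (d + 1) L ^ 2)) * (C₀ ^ 2 * (δ + 4 * (Real.exp β - 1) + ε))))) + 28 * C₀ ^ 2 * (δ + 4 * (Real.exp β - 1) + ε)) ≤ θ) →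
    ((K * ((Fintype.card (T4AveragingDeficitWall.Plane (d + 1)) : ℝ) * (((δ + 4 * (Real.exp β - 1) + ε) * (144 * C₀ * C₁ + 8 * C₁ ^ 2) + (δ + 4 * (Real.exp β - 1) + ε) ^ 2 * (5440 * C₀ ^ 3 + 304 * C₁ * C₀ ^ 2) + (δ + 4 * (Real.exp β - 1) + ε) ^ 3 * (2688 * C₀ ^ 4)) + 2 * ((δ + 4 * (Real.exp β - 1) + ε) * (144 * C₀ * (C₀ + C₁) + 8 * (C₀ + C₁) ^ 2) + (δ + 4 * (Real.exp β - 1) + ε) ^ 2 * (5440 * C₀ ^ 3 + 304 * (C₀ + C₁) * C₀ ^ 2) + (δ + 4 * (Real.exp β - 1) + ε) ^ 3 * (2688 * C₀ ^ 4))))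
      + K * Real.exp (-(c * ℓ)) * ((Fintype.card (T4AveragingDeficitWall.Plane (d + 1)) : ℝ) * (((δ + 4 * (Real.exp β - 1) + ε) * (144 * C₀ * C₁ + 8 * C₁ ^ 2) + (δ + 4 * (Real.exp β - 1) + ε) ^ 2 * (5440 * C₀ ^ 3 + 304 * C₁ * C₀ ^ 2) + (δ + 4 * (Real.exp β - 1) + ε) ^ 3 * (2688 * C₀ ^ 4)) + 2 * ((δ + 4 * (Real.exp β - 1) + ε) * (144 * C₀ * (C₀ + C₁) + 8 * (C₀ + C₁) ^ 2) + (δ + 4 * (Real.exp β - 1) + ε) ^ 2 * (5440 * C₀ ^ 3 + 304 * (C₀ + C₁) * C₀ ^ 2) + (δ + 4 * (Real.exp β - 1) + ε) ^ 3 * (2688 * C₀ ^ 4))) + 4 * (Fintype.card (T4AveragingDeficitWall.Plane (d + 1)) : ℝ) * (C₀ + C₁))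
      + (Fintype.card n : ℝ) * (2 * (CdecD d * (((d : ℝ) + 1) * (2 * ((d : ℝ) + 1))
              * ((2 + 32 / (kappa163 (d + 1) / (d + 1)) ^ 2) * latticeConst (d + 1) (kappa163 (d + 1) / (d + 1) / 2))))) * (1 + 12 * ((d : ℝ) + 1)) * ((28 * ((3 + 12 * ((d + 1 : ℕ) : ℝ)) + (4 * (3 + 12 * ((d + 1 : ℕ) : ℝ)) ^ 3 / rho0 (d + 1) L ^ 2) * (C₀ * (δ + 4 * (Real.exp β - 1) + ε))) ^ 2 + 4 * (4 * (3 + 12 * ((d + 1 : ℕ) : ℝ)) ^ 3 / rho0 (d + 1) L ^ 2)) * (C₀ ^ 2 * (δ + 4 * (Real.exp β - 1) + ε)))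
      + ((Fintype.card n : ℝ) * (2 * (CdecD d * (((d : ℝ) + 1) * (latticeConst (d + 1) (kappa163 (d + 1) / (d + 1) / 2) * Real.exp (-(kappa163 (d + 1) / (d + 1) / 2 * ℓ))))))) * ((3 + 12 * ((d + 1 : ℕ) : ℝ)) * C₀ + ((d : ℝ) + 1) * (4 * ((ℓ + 1 : ℕ) : ℝ) + 2) * (2 * (3 + 12 * ((d + 1 : ℕ) : ℝ)) * C₀ + ((28 * ((3 + 12 * ((d + 1 : ℕ) : ℝ)) + (4 * (3 + 12 * ((d + 1 : ℕ) : ℝ)) ^ 3 / rho0 (d + 1) L ^ 2) * (C₀ * (δ + 4 * (Real.exp β - 1) + ε))) ^ 2 + 4 * (4 * (3 + 12 * ((d + 1 : ℕ) : ℝ)) ^ 3 / rho0 (d + 1) L ^ 2)) * (C₀ ^ 2 * (δ + 4 * (Real.exp β - 1) + ε))))) + 28 * C₀ ^ 2 * (δ + 4 * (Real.exp β - 1) + ε)) * (4 * (Real.exp β - 1) + ε)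
      + ((Fintype.card n : ℝ) * (2 * (CdecD d * (((d : ℝ) + 1) * (2 * ((d : ℝ) + 1))
              * ((2 + 32 / (kappa163 (d + 1) / (d + 1)) ^ 2) * latticeConst (d + 1) (kappa163 (d + 1) / (d + 1) / 2))))) * (1 + 12 * ((d : ℝ) + 1)) + ((Fintype.card n : ℝ) * (2 * (CdecD d * (((d : ℝ) + 1) * (latticeConst (d + 1) (kappa163 (d + 1) / (d + 1) / 2) * Real.exp (-(kappa163 (d + 1) / (d + 1) / 2 * ℓ))))))) * (((d : ℝ) + 1) * (4 * ((ℓ + 1 : ℕ) : ℝ) + 2))) * (4 * (Real.exp β - 1)) ≤ c₀) →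
    -- THE CHART (N1)-weak: [B8] Thm 2 at `U₀ = 1` on nested cubes, TYPE (asserted for nothing here)
    (∀ D : Site (d + 1) → Fin (d + 1) → (Matrix n n ℂ)ˣ, IsUnitaryCfg D → IsPeriodicCfg D ((N * (4 * ℓ + 12)) : ℤ) → SmallField D (4 * (Real.exp β - 1)) →
      ∀ (k : ℕ), ∀ U ∈ admissible (sfClass (d + 1) L (N * (4 * ℓ + 12)) ε) L (k + 1) D,
      (∀ φ : Site (d + 1) → Fin (d + 1) → Matrix n n ℂ, IsSkewDir φ → IsPeriodicDir φ (((N * (4 * ℓ + 12)) * L ^ (k + 1) : ℕ) : ℤ) → TangentIter L k U φ →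
        dAction U φ (perWin (d + 1) ((N * (4 * ℓ + 12)) * L ^ (k + 1))) = 0) →
      ∀ r : ℝ, 0 ≤ r → r ≤ δ → SmallField U (r / ((L : ℝ) ^ (k + 1)) ^ 2) →
      ∀ z : Site (d + 1), ∃ (u : Site (d + 1) → (Matrix n n ℂ)ˣ) (At : Site (d + 1) → Fin (d + 1) → Matrix n n ℂ) (a₀ a₁ : ℝ),
        IsUnitarySite u ∧ (∀ (y : Site (d + 1)) (i : Fin (d + 1)), u (y + (((N * (4 * ℓ + 12)) * L ^ (k + 1) : ℕ) : ℤ) • e i) = u y) ∧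
        IsSkewDir At ∧ IsPeriodicDir At (((N * (4 * ℓ + 12)) * L ^ (k + 1) : ℕ) : ℤ) ∧ 0 ≤ a₀ ∧ 0 ≤ a₁ ∧
        (∀ (y : Site (d + 1)) (κ : Fin (d + 1)), ‖At y κ‖ ≤ a₀) ∧ (∀ (y : Site (d + 1)) (κ τ : Fin (d + 1)), ‖At (y + e τ) κ - At y κ‖ ≤ a₁) ∧
        (L : ℝ) ^ (k + 1) * a₀ ≤ C₀ * (r + 4 * (Real.exp β - 1) + ε) ∧ ((L : ℝ) ^ (k + 1)) ^ 2 * a₁ ≤ C₁ * (r + 4 * (Real.exp β - 1) + ε) ∧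
        (∀ (y : Site (d + 1)) (κ : Fin (d + 1)),
          torusSupNorm (fun _ : Fin (d + 1) => L ^ (k + 1) * (N * (4 * ℓ + 12))) (y - z) ≤ (((nbRad (d + 1) L + 2 * ℓ + 10) * L ^ (k + 1) : ℕ) : ℝ) →
            gaugeAct u U y κ = vary (flat (d := d + 1) (n := n)) At 1 y κ)) →
    -- ROW NE3's PER-PAIR BINDER on the data class (F31's `hleaves`, dimension `d + 1`)
    (∀ D : Site (d + 1) → Fin (d + 1) → (Matrix n n ℂ)ˣ, IsUnitaryCfg D → IsPeriodicCfg D (N : ℤ) → SmallField D (4 * (Real.exp β - 1)) → ∀ (k : ℕ), ∀ Us ∈ admissible (sfClass (d + 1) L N ε) L (k + 1) D, SmallField Us (δ₁ / ((L : ℝ) ^ (k + 1)) ^ 2) → (∀ φ : Site (d + 1) → Fin (d + 1) → Matrix n n ℂ, IsSkewDir φ → IsPeriodicDir φ ((N * L ^ (k + 1) : ℕ) : ℤ) → TangentIter L k Us φ → dAction Us φ (perWin (d + 1) (N * L ^ (k + 1))) = 0) → ∀ U' ∈ admissible (sfClass (d + 1) L N ε) L (k + 1) D, ∃ (u : Site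 (d + 1) → (Matrix n n ℂ)ˣ) (X₀ : Site (d + 1) → Fin (d + 1) → Matrix n n ℂ) (α₀ : ℝ) (m : Site (d + 1) → Fin (d + 1) → ℝ) (C : ℝ), IsSkewDir X₀ ∧ (∀ (hWu : IsUnitaryCfg Us) (hx : 0 ≤ ε / ((L : ℝ) ^ (k + 1)) ^ 2) (hs : LevelSmall (d + 1) L k (ε / ((L : ℝ) ^ (k + 1)) ^ 2)) (hWx : SmallField Us (ε / ((L : ℝ) ^ (k + 1)) ^ 2)) (hθ : cruxC (d + 1) L * (((L : ℝ) ^ (k + 1)) ^ 2 * (ε / ((L : ℝ) ^ (k + 1)) ^ 2)) < 1) (hφ : IsSkewDir (dirIter L (k + 1) Us X₀)), ResidualSliceRepT L N (k + 1) Us U' u X₀ (rightInvW hL k hWu hx hs hWx N hθ hφ) α₀) ∧ (∀ z κ, 0 ≤ m z κ) ∧ 0 ≤ C ∧ ((L : ℝ) ^ (k + 1)) ^ (d + 1) * ∑ z ∈ periodBox (d := d + 1) N, ∑ κ : Fin (d + 1), m z κ ^ 2 ≤ C ^ 2 * dirSq X₀ (periodBox (d := d + 1) (N * L ^ (k + 1)))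 ∧ (∀ z ∈ periodBox (d := d + 1) N, ∀ κ : Fin (d + 1), ‖dirIter L (k + 1) Us X₀ z κ‖ ≤ C₂ * ((L : ℝ) ^ (k + 1) * m z κ) ^ 2) ∧ α₀ * (L : ℝ) ^ (k + 1) ≤ αh ∧ (∀ z κ, m z κ * (L : ℝ) ^ (k + 1) ≤ αh) ∧ C ≤ Ch) →
    ∃ γ : ℝ, 0 < γ ∧ ∀ V : Site (d + 1) → Fin (d + 1) → (Matrix n n ℂ)ˣ, IsUnitaryCfg V → IsPeriodicCfg V (N : ℤ) → SmallField V γ →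
      ∀ (k : ℕ) (U₀ : Site (d + 1) → Fin (d + 1) → (Matrix n n ℂ)ˣ), U₀ ∈ admissible (sfClass (d + 1) L N ε) L (k + 1) V →
        SmallField U₀ (δ / ((L : ℝ) ^ k) ^ 2) →
        ∃ U, IsMinimiser (d + 1) (sfClass (d + 1) L N ε) L N (k + 1) V U ∧ SmallField U (δ / ((L : ℝ) ^ (k + 1)) ^ 2)
  := by
  obtain ⟨K, c, hK, hc, hF⟩ := hape_of_localChart_budget_allN (d := d) (n := n) hL
  refine ⟨K, c, hK, hc, ?_⟩
  intro N ℓ _ ε δ δ₁ CP β c₀ θ C₀ C₁ C₂ αh Ch νh κh hN hε hε1 hε2 hδ₁ hδ₁δ hδε hCP hβ hls hP hθl hε1' hC₂ hαh0 hαh1 hCh0 hνh hκh hν hline hℓ hc₀ hθ0 hθ1 hcδ hcδ₁ hθc hC₀ hC₁ hσ hKd hS hC₀T hbr hbc hchart hleaves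
  exact oneStep_of_dataClass_ape_routePi (d := d + 1) hL hN hε hε1 hε2 hδ₁ hδ₁δ hδε hCP hβ hls hP hθl hε1' hC₂ hαh0 hαh1 hCh0 hνh hκh hν hline
    (hF N ℓ ε δ δ₁ β c₀ θ C₀ C₁ hℓ hc₀ hθ0 hθ1 hcδ hcδ₁ hβ.le hε.le hε1' hθc hθl hls hC₀ hC₁ hσ hKd hS hC₀T hbr hbc hchart)
    hleaves

end Summit.QuantumFields.BalabanUV.T4Continuum.NE7OneStepOfLocalChart
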